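import Mathlib.Analysis.Complex.JensenFormula
import Mathlib.Analysis.Fourier.RiemannLebesgueLemma
import Mathlib.Analysis.Calculus.ParametricIntegral
import Literature.Analysis.Fourier.FourierUniquenessL1
import Literature.NumberTheory.LFunctions.ZetaScrewHermitianForms
import Literature.NumberTheory.LFunctions.ZetaScrewProp31Proofs
import Literature.NumberTheory.LFunctions.ZeroGapsHolds
import Literature.NumberTheory.LFunctions.ZetaArgVariation
import Literature.NumberTheory.LFunctions.RiemannXiProofs
import Literature.NumberTheory.LFunctions.WeilExplicitFormulaProofs
import HarnessLib

/-!
# Suzuki's Lemma 2.1 (an entire function of exponential type constant on the zeros of `ξ(1/2 − iz)` is constant) — PROOF; Part II: its application, Thm. 1.3 "Moreover" and Thm. 1.4 (⟹)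

LINE 1 — LABEL: Part I is RH-FREE (every declaration a theorem proved here; no named fact); Part II
is RH-FREE in Steps 1, 2, 4, 5 and an explicit RH-CONSEQUENCE (binder `RiemannHypothesis →` in the
statement) in Step 3, `Suzuki2023_thm13_posdef_holds` and `isScrewFormNondegenerate_of_riemannHypothesis`;
nothing is asserted about the truth of RH. bears_on: LADDER-RH B-C/B-P (COLUMN 6 DBR) — record only.
WHAT THIS IS NOT: not a route and not progress toward RH; a classical uniqueness lemma and the
CONSEQUENCE direction "RH ⟹ strict positivity / non-degeneracy" of Suzuki's criteria; nothing
here bears on the truth of RH.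

Source: M. Suzuki, J. Lond. Math. Soc. (2) 108 (2023) = arXiv:2206.03682 [`Suzuki2023`], §2.4
Lemma 2.1 (held text `paper:arxiv-2206.03682` p0006:L171–180): "Let `F(z)` be an entire function of
the exponential type and let `A` be a complex number. Suppose that `F(γ) = A` for all zeros `γ` of
`ξ(1/2 − iz)`. Then `F(z) = A` as a function." Typed in `ZetaScrewHermitianForms.lean` as
`Suzuki2023_lemma21`; discharged here as `Suzuki2023_lemma21_holds`.

## The proof (as printed, with the tree's inputs)

Printed: "The number of zeros of `F(z)` in the disc `|z| ≤ r` counted with multiplicity is `O(r)`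
by the assumption. On the other hand, the number of distinct zeros of `ξ(1/2 − z)` in the disc
`|z| ≤ r` is not `O(r)` by [Tit86, Section 9.12], which was first proved by Littlewood. This is a
contradiction if `F ≠ 0`." (The source adds that Conrey's proportion of simple zeros is a more
convenient input.) Here:

* `O(r)` zeros: Jensen's inequality (Mathlib `AnalyticOnNhd.sum_divisor_le`) for `G = F − A` on
  the discs `|w − z| ≤ r < 2r` centred at a point `z` with `G(z) ≠ 0`, with `|G| ≤ (C+|A|+1)e^{R⁺(|z|+2r)}`:
  the divisor of `G` on `|w − z| ≤ r` has total mass `≤ (R⁺(|z|+2r) + const)/log 2`, affine in `r`.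
* "not `O(r)`" distinct zeros: the tree's PROVED Selberg–Fujii large-gap theorem
  `selberg_fujii_large_gaps_holds` (Titchmarsh (9.25.5): for `T ≥ T₀` at least `A·N(T)` indices
  `n < N(T)` have `(γ_{n+1} − γ_n) log γ_n/2π ≥ λ > 1`, in particular `γ_{n+1} > γ_n`) supplies
  `≥ A·N(T)` DISTINCT ordinates `γ_n ≤ T`; by `exists_zero_of_zetaOrdinate_holds` and
  `riemannXi_eq_zero_iff_holds` each is the ordinate of a zero `ρ_n` of `ξ`, i.e. of a zero
  `w_n = i(ρ_n − 1/2)` of `ξ(1/2 − iz)` with `|w_n| ≤ T + 1/2` and `Re w_n = −γ_n` (pairwise distinct);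
  and `N(T) ≥ K·T` eventually for every `K` by the Riemann–von Mangoldt formula
  (`riemann_von_mangoldt_holds`) — so the distinct zeros are not `O(r)`.
  (Deviation from the printed citation only: Selberg's theorem replaces Littlewood's §9.12; both are
  unconditional and either suffices, as the source itself remarks for Conrey's.)

# PART II (appended 2026-08-26) — the application of Lemma 2.1 in the source: Theorem 1.3, "Moreover" clause (`⟨φ,φ⟩_{G_g,a} > 0` on `L²(−a,a) ∖ {0}` under RH) and Theorem 1.4 (⟹)

(Filed in this module rather than a sibling because it is Lemma 2.1's one use in the paper and
the two share the zero-set dictionary `γ = iκ_ρ`; declarations of Part I above are unchanged.)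

LINE 1 — LABEL: every theorem here is either RH-FREE (Steps 1, 2, 4, 5: identities and analytic
lemmas valid unconditionally) or an explicit RH-CONSEQUENCE with the binder `RiemannHypothesis →`
in its statement (Step 3, `Suzuki2023_thm13_posdef_holds`, `isScrewFormNondegenerate_of_riemannHypothesis`);
no named fact, nothing asserted about the truth of RH. bears_on: LADDER-RH B-C/B-P (COLUMN 6 DBR)
— record only. WHAT THIS IS NOT: not a route and not progress toward RH: it is the CONSEQUENCE
direction "RH ⟹ strict positivity / non-degeneracy" of Suzuki's criteria; nothing here bears on
the truth of RH.

Source: M. Suzuki, J. Lond. Math. Soc. (2) 108 (2023) = arXiv:2206.03682 [`Suzuki2023`], Thm. 1.3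
(p. 3, held text `paper:arxiv-2206.03682` p0003:L56–66: "Moreover, assuming the RH, hermitian forms
`⟨·,·⟩_{G_g,a}` are positive definite on `L²(−a,a)` for every `0 < a < ∞`") and its proof in §3.1
(p. 7, p0007:L31–58): (3.1) `⟨φ₁,φ₂⟩_{G_g,a} = Σ_γ [(φ̂₁(−γ) − φ̂₁(0))/γ][(φ̄̂₂(γ) − φ̄̂₂(0))/γ]`
by termwise integration of (1.9); (3.2) under RH the two factors are conjugate and the sum is
`Σ_γ |(φ̂(γ) − φ̂(0))/γ|² ≥ 0`; equality forces `φ̂(γ) = φ̂(0)` at all zeros `γ` of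
`ξ(1/2 − iz)`, so `φ̂` is constant by Lemma 2.1, hence `φ = 0`. Discharges the named fact
`Suzuki2023_thm13_posdef` of `ZetaScrewHermitianForms.lean`, and proves the `⟹` direction of
Thm. 1.4 (`isScrewFormNondegenerate_of_riemannHypothesis`).

## The proof as formalized (same architecture; `κ_ρ = ρ − 1/2 = −iγ`, `D_φ(s) = ∫_{−a}^{a}(e^{su} − 1)φ(u)du = φ̂ − φ̂(0)` in `s = −iz`)

* Step 1 `integral_kernelTerm_mul`: the elementary identity
  `c(t) + c(u) − c(t−u) = −(2κ²)⁻¹[(e^{κt}−1)(e^{−κu}−1) + (e^{−κt}−1)(e^{κu}−1)]`,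
  `c(x) = (cosh κx − 1)/κ²`, turns one term of (1.9) integrated against `f(u)g(t)` over `(−a,a)²`
  into `−(2κ²)⁻¹[D_g(κ)D_f(−κ) + D_g(−κ)D_f(κ)]` (Fubini for products).
* Step 2 `zetaScrewForm_eq_integral_prod`, `hasSum_integral_term`, `hasSum_zetaScrewForm` (= (3.1)
  for all pairs `φ₁, φ₂ ∈ L¹(−a,a) ⊃ L²(−a,a)`, unconditionally): (1.10) is the integral over the
  square, and the series (1.9)
  (`ZetaScrewProp31.hasSum_zetaScrewKernel`) may be integrated termwise — dominated convergence with
  the majorant `3(cosh a + 1)·m(ρ)/|κ_ρ|²·|φ(u)||φ(t)|`, summable by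
  `ZetaScrewProp31.summable_zeroOrder_div_norm_sub_half_sq`.
* Step 3 `integral_term_of_RH`: under RH `conj κ_ρ = −κ_ρ`, `κ_ρ² = −(Im ρ)²`, and with
  `g = conj φ`, `D_g(±κ) = conj D_φ(∓κ)`: the `ρ`-th term is the real number
  `m(ρ)(|D_φ(κ_ρ)|² + |D_φ(−κ_ρ)|²)/(2(Im ρ)²) ≥ 0` — this is (3.2).
* Step 4 `differentiable_expMoment`, `norm_expMoment_le`: `D_φ` is entire (differentiation under
  the integral) with `|D_φ(s)| ≤ (e^{a|s|} + 1)‖φ‖₁` (exponential type).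
* Step 5 `ae_eq_zero_of_forall_expMoment`: if `D_φ ≡ 0` then `𝓕(𝟙_{(−a,a)}φ)` is the constant
  `∫φ`, which is `0` by the Riemann–Lebesgue lemma (Mathlib `Real.zero_at_infty_fourier`), so
  `φ = 0` a.e. by the uniqueness theorem `Literature.Analysis.Fourier.ae_eq_zero_of_forall_fourier_eq_zero`.
* Assembly `Suzuki2023_thm13_posdef_holds`: the sum of the non-negative terms is `> 0` unless
  every term vanishes, i.e. `D_φ(κ_ρ) = 0` for all `ρ`; then `F(w) = D_φ(−iw)` is entire of
  exponential type with `F(γ) = 0` at every zero of `ξ(1/2 − iz)`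
  (`mem_riemannZetaNontrivialZeros_of_riemannXi_eq_zero`), so `F ≡ 0` by
  `Suzuki2023_lemma21_holds`, `D_φ ≡ 0`, and Step 5 gives `φ = 0` in `L²`, a contradiction.
-/

noncomputable section

open Complex Set Filter Metric MeromorphicOn
open scoped Real Topology

namespace Literature.NumberTheory.LFunctions

namespace ZetaScrewLemma21

/-- From the Riemann–von Mangoldt formula: for every `K`, eventually `K·T ≤ N(T)`
(indeed `N(T) ~ (T/2π) log T`). The same statement is proved Summits-side as
`Summit.RiemannHypothesis.RiemannHypothesis.Theorems.LatticeUncertainty.eventually_mul_le_zetaZeroCount`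
(`HandoffLatticeTailRigidity.lean`), which Literature cannot import; re-proved here from
`riemann_von_mangoldt_holds` (variant of `riemann_von_mangoldt.eventually_self_le`). [cite: Titchmarsh1986, Thm. 9.4] -/
theorem eventually_mul_le_zetaZeroCount (K : ℝ) :
    ∀ᶠ T : ℝ in atTop, K * T ≤ (zetaZeroCount T : ℝ) := by
  obtain ⟨C₀, hC₀, hbd⟩ := riemann_von_mangoldt_holds.exists_pos
  set K' : ℝ := max K 0 with hK'
  have hK'0 : 0 ≤ K' := le_max_right _ _
  have h2 : ∀ᶠ T : ℝ in atTop, 2 + 2 * π * K' ≤ Real.log (T / (2 * π)) :=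
    (Real.tendsto_log_atTop.comp (tendsto_id.atTop_div_const (by positivity))).eventually_ge_atTop
      _
  have h3 : ∀ᶠ T : ℝ in atTop, ‖Real.log T‖ ≤ (1 / (2 * π * C₀)) * ‖T‖ :=
    Real.isLittleO_log_id_atTop.def (by positivity)
  filter_upwards [hbd.bound, h2, h3, eventually_ge_atTop (1 : ℝ)] with T hb h2 h3 h1
  rw [Real.norm_of_nonneg (Real.log_nonneg h1)] at hb h3
  rw [Real.norm_of_nonneg (by linarith : (0 : ℝ) ≤ T)] at h3
  rw [Real.norm_eq_abs] at hb
  have hb' := (abs_le.1 hb).1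
  have h4 : T / (2 * π) * (2 + 2 * π * K') ≤ T / (2 * π) * Real.log (T / (2 * π)) :=
    mul_le_mul_of_nonneg_left h2 (by positivity)
  have h5 : C₀ * Real.log T ≤ T / (2 * π) := by
    calc C₀ * Real.log T ≤ C₀ * ((1 / (2 * π * C₀)) * T) :=
          mul_le_mul_of_nonneg_left h3 hC₀.le
      _ = T / (2 * π) := by field_simp
  have h6 : T / (2 * π) * (2 + 2 * π * K') = 2 * (T / (2 * π)) + K' * T := by field_simp
  have h7 : K * T ≤ K' * T := mul_le_mul_of_nonneg_right (le_max_left _ _) (by linarith)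
  linarith

/-- An index with a positive normalised gap has `γ_{n+1} > γ_n`. [folklore] -/
private theorem zetaOrdinate_lt_succ_of_gap {n : ℕ} {l : ℝ} (hl : 0 < l)
    (h : l ≤ zetaNormalizedGap n) : zetaOrdinate n < zetaOrdinate (n + 1) := by
  have hmono := riemann_von_mangoldt_holds.zetaOrdinate_mono (Nat.le_succ n)
  rcases hmono.lt_or_eq with hlt | heq
  · exact hlt
  · exfalso
    have : zetaNormalizedGap n = 0 := by rw [zetaNormalizedGap, ← heq, sub_self, zero_div]
    linarith

/-- On the set of indices with a positive normalised gap, `n ↦ γ_n` is injective. [folklore] -/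
private theorem zetaOrdinate_injOn_gap {l : ℝ} (hl : 0 < l) {n n' : ℕ}
    (hn : l ≤ zetaNormalizedGap n) (hn' : l ≤ zetaNormalizedGap n')
    (h : zetaOrdinate n = zetaOrdinate n') : n = n' := by
  by_contra hne
  rcases Nat.lt_or_gt_of_ne hne with hlt | hlt
  · have h1 := zetaOrdinate_lt_succ_of_gap hl hn
    have h2 := riemann_von_mangoldt_holds.zetaOrdinate_mono (Nat.succ_le_of_lt hlt)
    linarith
  · have h1 := zetaOrdinate_lt_succ_of_gap hl hn'
    have h2 := riemann_von_mangoldt_holds.zetaOrdinate_mono (Nat.succ_le_of_lt hlt)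
    linarith

/-- A zero of `ξ(1/2 − iz)` above each zero of `ζ` in the strip: for `ρ = σ + iγ` with `ζ(ρ) = 0`,
`0 < σ < 1`, the point `w = i(ρ − 1/2)` satisfies `ξ(1/2 − iw) = ξ(ρ) = 0`
(`riemannXi_eq_zero_iff_holds`). [folklore] -/
private theorem riemannXi_half_sub_I_mul {σ γ : ℝ} (h0 : 0 < σ) (h1 : σ < 1)
    (hζ : riemannZeta ((σ : ℂ) + (γ : ℂ) * I) = 0) :
    riemannXi (1 / 2 - I * (I * ((σ : ℂ) + (γ : ℂ) * I - 1 / 2))) = 0 := by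
  have hs : 1 / 2 - I * (I * ((σ : ℂ) + (γ : ℂ) * I - 1 / 2)) = (σ : ℂ) + (γ : ℂ) * I := by
    linear_combination (-((σ : ℂ) + (γ : ℂ) * I - 1 / 2)) * Complex.I_mul_I
  rw [hs, riemannXi_eq_zero_iff_holds]
  refine ⟨hζ, ?_, ?_⟩ <;> simp [h0, h1]

/-- `Re (i(σ + iγ − 1/2)) = −γ`. [folklore] -/
private theorem re_I_mul (σ γ : ℝ) : (I * ((σ : ℂ) + (γ : ℂ) * I - 1 / 2)).re = -γ := by
  simp

/-- `|i(σ + iγ − 1/2)| ≤ γ + 1/2` for `0 < σ < 1`, `0 < γ`. [folklore] -/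
private theorem norm_I_mul_le {σ γ : ℝ} (h0 : 0 < σ) (h1 : σ < 1) (hγ : 0 < γ) :
    ‖I * ((σ : ℂ) + (γ : ℂ) * I - 1 / 2)‖ ≤ γ + 1 / 2 := by
  rw [norm_mul, Complex.norm_I, one_mul]
  calc ‖(σ : ℂ) + (γ : ℂ) * I - 1 / 2‖
      = ‖(((σ - 1 / 2 : ℝ) : ℂ)) + (γ : ℂ) * I‖ := by push_cast; ring_nf
    _ ≤ ‖((σ - 1 / 2 : ℝ) : ℂ)‖ + ‖(γ : ℂ) * I‖ := norm_add_le _ _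
    _ = |σ - 1 / 2| + γ := by
        rw [Complex.norm_real, Real.norm_eq_abs, norm_mul, Complex.norm_I, mul_one,
          Complex.norm_real, Real.norm_eq_abs, abs_of_pos hγ]
    _ ≤ γ + 1 / 2 := by
        have : |σ - 1 / 2| ≤ 1 / 2 := by rw [abs_le]; constructor <;> linarith
        linarith

end ZetaScrewLemma21

open ZetaScrewLemma21 in
/-- **DISCHARGE of `Suzuki2023_lemma21` (Suzuki2023 Lemma 2.1):** an entire function of exponential
type taking the value `A` at every zero of `ξ(1/2 − iz)` is identically `A`. Jensen's inequality
(`O(r)` zeros of `F − A`) against the Selberg–Fujii large gaps (`selberg_fujii_large_gaps_holds`: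
`≫ N(T)` distinct ordinates) and the Riemann–von Mangoldt formula (`N(T)/T → ∞`); see the module
docstring. [cite: Suzuki2023, Lemma 2.1, p. 6 (held text p0006:L171–180)] -/
theorem Suzuki2023_lemma21_holds : Suzuki2023_lemma21 := by
  intro F hF hexp A hFA z
  obtain ⟨C, R, hCR⟩ := hexp
  by_contra hz
  -- the function `G = F − A`, entire, of exponential type, `G z ≠ 0`
  set G : ℂ → ℂ := fun w ↦ F w - A with hGdef
  have hGd : Differentiable ℂ G := hF.sub_const A
  have hGz : G z ≠ 0 := sub_ne_zero.mpr hz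
  have hC0 : 0 ≤ C := (norm_nonneg _).trans ((hCR 0).trans (by simp))
  set R' : ℝ := max R 0 with hR'
  have hR'0 : 0 ≤ R' := le_max_right _ _
  set C' : ℝ := C + ‖A‖ + 1 with hC'
  have hC'1 : 1 ≤ C' := by rw [hC']; linarith [norm_nonneg A]
  have hGbd : ∀ w, ‖G w‖ ≤ C' * Real.exp (R' * ‖w‖) := by
    intro w
    have h1 : ‖F w‖ ≤ C * Real.exp (R' * ‖w‖) :=
      (hCR w).trans (mul_le_mul_of_nonneg_left
        (Real.exp_le_exp.2 (mul_le_mul_of_nonneg_right (le_max_left _ _) (norm_nonneg _))) hC0)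
    have h2 : (1 : ℝ) ≤ Real.exp (R' * ‖w‖) := Real.one_le_exp (by positivity)
    calc ‖G w‖ ≤ ‖F w‖ + ‖A‖ := norm_sub_le _ _
      _ ≤ C * Real.exp (R' * ‖w‖) + (‖A‖ + 1) * Real.exp (R' * ‖w‖) := by
          nlinarith [norm_nonneg A]
      _ = C' * Real.exp (R' * ‖w‖) := by rw [hC']; ring
  -- the zeros `w_n = i(ρ_n − 1/2)` of `G`, one above each ordinate `γ_n`
  choose σf hσf using exists_zero_of_zetaOrdinate_holds
  set w : ℕ → ℂ := fun n ↦ I * (((σf n : ℝ) : ℂ) + (zetaOrdinate n : ℂ) * I - 1 / 2) with hw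
  have hGw : ∀ n, G (w n) = 0 := fun n ↦ by
    simp only [hGdef, hw]
    rw [hFA _ (riemannXi_half_sub_I_mul (hσf n).1 (hσf n).2.1 (hσf n).2.2), sub_self]
  have hre : ∀ n, (w n).re = -zetaOrdinate n := fun n ↦ by
    simp only [hw]; exact re_I_mul _ _
  have hnorm : ∀ n, ‖w n‖ ≤ zetaOrdinate n + 1 / 2 := fun n ↦ by
    simp only [hw]
    exact norm_I_mul_le (hσf n).1 (hσf n).2.1 (riemann_von_mangoldt_holds.zetaOrdinate_pos n)
  -- Jensen: for `T ≥ 0` and `r = T + ‖z‖ + 1`, the indices with a gap `≥ l`, `n < N(T)`, are at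
  -- most `log(M/‖G z‖)/log 2`, `M = C' e^{R'(‖z‖ + 2r)}`
  have jensen : ∀ (l : ℝ), 0 < l → ∀ T : ℝ, 0 ≤ T →
      ((((Finset.range (zetaZeroCount T)).filter fun n ↦ l ≤ zetaNormalizedGap n).card : ℝ)) ≤
        (Real.log C' + R' * (‖z‖ + 2 * (T + ‖z‖ + 1)) - Real.log ‖G z‖) / Real.log 2 := by
    intro l hl T hT
    set S := (Finset.range (zetaZeroCount T)).filter fun n ↦ l ≤ zetaNormalizedGap n with hS
    set r : ℝ := T + ‖z‖ + 1 with hr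
    have hr0 : 0 < r := by rw [hr]; positivity
    set M : ℝ := C' * Real.exp (R' * (‖z‖ + 2 * r)) with hM
    have hM1 : 1 ≤ M := by
      rw [hM]; nlinarith [Real.one_le_exp (by positivity : 0 ≤ R' * (‖z‖ + 2 * r))]
    -- Jensen's inequality for `G` on `|w − z| ≤ r < 2r`
    have hGan : AnalyticOnNhd ℂ G (closedBall z |2 * r|) := fun w _ ↦ hGd.analyticAt w
    have hGM : ∀ w ∈ sphere z |2 * r|, ‖G w‖ ≤ M := by
      intro w hw
      rw [abs_of_pos (by positivity), mem_sphere, dist_eq_norm] at hw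
      have hwn : ‖w‖ ≤ ‖z‖ + 2 * r := by
        calc ‖w‖ = ‖(w - z) + z‖ := by rw [sub_add_cancel]
          _ ≤ ‖w - z‖ + ‖z‖ := norm_add_le _ _
          _ = ‖z‖ + 2 * r := by rw [hw]; ring
      calc ‖G w‖ ≤ C' * Real.exp (R' * ‖w‖) := hGbd w
        _ ≤ C' * Real.exp (R' * (‖z‖ + 2 * r)) := by gcongr
    have hJ := AnalyticOnNhd.sum_divisor_le (f := G) (c := z) (r := r) (R := 2 * r)
      (by rwa [abs_of_pos hr0]) (by rw [abs_of_pos hr0, abs_of_pos (by positivity)]; linarith)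
      hM1 hGan hGz hGM
    have hlog2 : (2 * r) / r = 2 := by field_simp
    rw [hlog2, abs_of_pos hr0] at hJ
    have hlogM : Real.log (M / ‖G z‖) =
        Real.log C' + R' * (‖z‖ + 2 * (T + ‖z‖ + 1)) - Real.log ‖G z‖ := by
      rw [Real.log_div (by positivity) (norm_ne_zero_iff.mpr hGz), hM,
        Real.log_mul (by positivity) (Real.exp_ne_zero _), Real.log_exp]
    rw [hlogM] at hJ
    refine le_trans ?_ hJ
    -- each `w_n`, `n ∈ S`, carries divisor `≥ 1`, and the `w_n` are pairwise distinct
    set U := closedBall z r with hU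
    have hGanU : AnalyticOnNhd ℂ G U := fun w _ ↦ hGd.analyticAt w
    have hmer : MeromorphicOn G U := hGanU.meromorphicOn
    set D := divisor G U with hD
    have hfin : (Function.support fun u ↦ (D u : ℝ)).Finite := by
      refine (D.finiteSupport (isCompact_closedBall _ _)).subset fun u hu ↦ ?_
      simpa using hu
    have hcast : ((∑ᶠ u, D u : ℤ) : ℝ) = ∑ᶠ u, (D u : ℝ) :=
      map_finsum (Int.castRingHom ℝ) (D.finiteSupport (isCompact_closedBall _ _))
    rw [hcast, finsum_eq_sum_of_support_subset _ (s := hfin.toFinset) (by simp)]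
    have hwU : ∀ n ∈ S, w n ∈ U := by
      intro n hn
      rw [hS, Finset.mem_filter, Finset.mem_range] at hn
      have hγT : zetaOrdinate n ≤ T := riemann_von_mangoldt_holds.zetaOrdinate_le_iff.2 hn.1
      rw [hU, mem_closedBall, dist_eq_norm]
      calc ‖w n - z‖ ≤ ‖w n‖ + ‖z‖ := norm_sub_le _ _
        _ ≤ (zetaOrdinate n + 1 / 2) + ‖z‖ := by gcongr; exact hnorm n
        _ ≤ r := by rw [hr]; linarith
    have hDw : ∀ n ∈ S, (1 : ℝ) ≤ D (w n) := by
      intro n hn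
      have hxU := hwU n hn
      rw [hD, divisor_apply hmer hxU]
      have han : AnalyticAt ℂ G (w n) := hGanU _ hxU
      have hne_top : analyticOrderAt G (w n) ≠ ⊤ := by
        intro htop
        rw [analyticOrderAt_eq_top] at htop
        have hpre : IsPreconnected U := (convex_closedBall z r).isPreconnected
        have hcU : z ∈ U := mem_closedBall_self hr0.le
        have := hGanU.eqOn_zero_of_preconnected_of_eventuallyEq_zero hpre hxU htop hcU
        exact hGz this
      have hpos : 0 < analyticOrderAt G (w n) := by
        rw [pos_iff_ne_zero, Ne, han.analyticOrderAt_eq_zero]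
        exact not_not.2 (hGw n)
      obtain ⟨m, hm⟩ := ENat.ne_top_iff_exists.mp hne_top
      rw [← hm] at hpos
      have hm1 : 1 ≤ m := Nat.one_le_iff_ne_zero.2 (by rintro rfl; simp at hpos)
      rw [han.meromorphicOrderAt_eq, ← hm, ENat.map_coe, WithTop.untop₀_coe]
      exact_mod_cast hm1
    have hinj : Set.InjOn w S := by
      intro n hn n' hn' h
      rw [hS, Finset.coe_filter, mem_setOf_eq] at hn hn'
      have hre' := congrArg Complex.re h
      rw [hre, hre, neg_inj] at hre'
      exact zetaOrdinate_injOn_gap hl hn.2 hn'.2 hre'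
    have hsub : S.image w ⊆ hfin.toFinset := by
      intro u hu
      rw [Finset.mem_image] at hu
      obtain ⟨n, hn, rfl⟩ := hu
      rw [Set.Finite.mem_toFinset, Function.mem_support]
      linarith [hDw n hn]
    calc (S.card : ℝ) = ∑ n ∈ S, (1 : ℝ) := by simp
      _ ≤ ∑ n ∈ S, (D (w n) : ℝ) := Finset.sum_le_sum hDw
      _ = ∑ u ∈ S.image w, (D u : ℝ) :=
          (Finset.sum_image (f := fun u : ℂ ↦ (D u : ℝ)) hinj).symm
      _ ≤ ∑ u ∈ hfin.toFinset, (D u : ℝ) :=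
          Finset.sum_le_sum_of_subset_of_nonneg hsub fun u _ _ ↦ by
            exact_mod_cast hGanU.divisor_nonneg u
  -- Selberg–Fujii large gaps and Riemann–von Mangoldt: too many distinct zeros
  obtain ⟨l, hl, Asf, hAsf, T₀, hSF⟩ := selberg_fujii_large_gaps_holds
  have hl0 : 0 < l := by linarith
  -- the affine Jensen bound `a T + b`
  set a : ℝ := 2 * R' / Real.log 2 with ha
  set b : ℝ := (Real.log C' + R' * (3 * ‖z‖ + 2) - Real.log ‖G z‖) / Real.log 2 with hb
  have hlog2 : 0 < Real.log 2 := Real.log_pos one_lt_two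
  set K : ℝ := (a + |b| + 1) / Asf with hK
  obtain ⟨T, hKT, hT₀, hT1⟩ := ((eventually_mul_le_zetaZeroCount K).and
    ((eventually_ge_atTop T₀).and (eventually_ge_atTop (1 : ℝ)))).exists
  have hJT := jensen l hl0 T (by linarith)
  have hSFT := hSF T hT₀
  have hcount : Asf * (K * T) ≤ a * T + b := by
    calc Asf * (K * T) ≤ Asf * (zetaZeroCount T : ℝ) := mul_le_mul_of_nonneg_left hKT hAsf.le
      _ ≤ _ := hSFT
      _ ≤ _ := hJT
      _ = a * T + b := by rw [ha, hb]; field_simp; ring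
  have hK' : Asf * (K * T) = (a + |b| + 1) * T := by rw [hK]; field_simp
  rw [hK'] at hcount
  nlinarith [le_abs_self b, abs_nonneg b]

end Literature.NumberTheory.LFunctions

end

/-! # PART II — Theorem 1.3 "Moreover" and Theorem 1.4 (⟹) -/


noncomputable section

open MeasureTheory Set Filter Complex
open scoped ComplexConjugate ComplexOrder Topology Real FourierTransform

namespace Literature.NumberTheory.LFunctions

namespace ZetaScrewPosdef

open ZetaScrewProp31

variable {a : ℝ}

/-! ### Step 1. The kernel term as a sum of two separated products -/

/-- `c(t) + c(u) − c(t−u) = −(2κ²)⁻¹[(e^{κt} − 1)(e^{−κu} − 1) + (e^{−κt} − 1)(e^{κu} − 1)]`,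
`c(x) = (cosh κx − 1)/κ²`, `κ ≠ 0`. [folklore] -/
private theorem kernelTerm_eq {κ : ℂ} (hκ : κ ≠ 0) (t u : ℝ) :
    (Complex.cosh (κ * t) - 1) / κ ^ 2 + (Complex.cosh (κ * u) - 1) / κ ^ 2
        - (Complex.cosh (κ * ((t - u : ℝ) : ℂ)) - 1) / κ ^ 2 =
      -(2 * κ ^ 2)⁻¹ * ((cexp (κ * t) - 1) * (cexp (-(κ * u)) - 1)
        + (cexp (-(κ * t)) - 1) * (cexp (κ * u) - 1)) := by
  have hcosh : Complex.cosh (κ * ((t - u : ℝ) : ℂ)) =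
      (cexp (κ * t) * cexp (-(κ * u)) + cexp (-(κ * t)) * cexp (κ * u)) / 2 := by
    rw [Complex.cosh, ← Complex.exp_add, ← Complex.exp_add]
    push_cast
    congr 1
    · congr 1 <;> ring_nf
  rw [hcosh]
  simp only [Complex.cosh]
  field_simp
  ring

/-- `‖e^{κx} − 1‖ ≤ e^{‖κ‖a} + 1` for `|x| ≤ a`. [folklore] -/
private theorem norm_exp_sub_one_le (κ : ℂ) {x a : ℝ} (hx : |x| ≤ a) :
    ‖cexp (κ * x) - 1‖ ≤ Real.exp (‖κ‖ * a) + 1 := by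
  calc ‖cexp (κ * x) - 1‖ ≤ ‖cexp (κ * x)‖ + ‖(1 : ℂ)‖ := norm_sub_le _ _
    _ ≤ Real.exp (‖κ‖ * a) + 1 := by
        rw [norm_one, Complex.norm_exp]
        gcongr
        calc (κ * x).re ≤ ‖κ * (x : ℂ)‖ := Complex.re_le_norm _
          _ = ‖κ‖ * |x| := by rw [norm_mul, Complex.norm_real, Real.norm_eq_abs]
          _ ≤ ‖κ‖ * a := by gcongr

/-- On `(−a, a)`: a.e. `|x| ≤ a`. [folklore] -/
private theorem ae_abs_le : ∀ᵐ x ∂(volume.restrict (Ioo (-a) a)), |x| ≤ a :=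
  (ae_restrict_mem measurableSet_Ioo).mono fun _ hx ↦ abs_le.2 ⟨hx.1.le, hx.2.le⟩

/-- `t ↦ (e^{κt} − 1) h(t)` is integrable on `(−a,a)` for `h` integrable there. [folklore] -/
private theorem integrable_exp_sub_one_mul (κ : ℂ) {h : ℝ → ℂ}
    (hh : Integrable h (volume.restrict (Ioo (-a) a))) :
    Integrable (fun x : ℝ ↦ (cexp (κ * x) - 1) * h x) (volume.restrict (Ioo (-a) a)) :=
  hh.bdd_mul (Continuous.aestronglyMeasurable (by fun_prop))
    (ae_abs_le.mono fun _ hx ↦ norm_exp_sub_one_le κ hx)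

/-- **Step 1**: one term of (1.9) integrated against `f(u) g(t)` over the square splits into
two products of one-dimensional integrals (the computation behind (3.1)). [cite: Suzuki2023, §3.1 eq. (3.1), p. 7] -/
theorem integral_kernelTerm_mul {κ : ℂ} (hκ : κ ≠ 0) {f g : ℝ → ℂ}
    (hf : Integrable f (volume.restrict (Ioo (-a) a)))
    (hg : Integrable g (volume.restrict (Ioo (-a) a))) :
    ∫ z, ((Complex.cosh (κ * (z.1 : ℂ)) - 1) / κ ^ 2 + (Complex.cosh (κ * (z.2 : ℂ)) - 1) / κ ^ 2
        - (Complex.cosh (κ * ((z.1 - z.2 : ℝ) : ℂ)) - 1) / κ ^ 2) * f z.2 * g z.1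
        ∂((volume.restrict (Ioo (-a) a)).prod (volume.restrict (Ioo (-a) a))) =
      -(2 * κ ^ 2)⁻¹ *
        ((∫ t, (cexp (κ * t) - 1) * g t ∂(volume.restrict (Ioo (-a) a))) *
            (∫ u, (cexp (-κ * u) - 1) * f u ∂(volume.restrict (Ioo (-a) a))) +
          (∫ t, (cexp (-κ * t) - 1) * g t ∂(volume.restrict (Ioo (-a) a))) *
            (∫ u, (cexp (κ * u) - 1) * f u ∂(volume.restrict (Ioo (-a) a)))) := by
  have hpt : ∀ z : ℝ × ℝ,
      ((Complex.cosh (κ * (z.1 : ℂ)) - 1) / κ ^ 2 + (Complex.cosh (κ * (z.2 : ℂ)) - 1) / κ ^ 2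
        - (Complex.cosh (κ * ((z.1 - z.2 : ℝ) : ℂ)) - 1) / κ ^ 2) * f z.2 * g z.1 =
      -(2 * κ ^ 2)⁻¹ * (((cexp (κ * z.1) - 1) * g z.1) * ((cexp (-κ * z.2) - 1) * f z.2)
        + ((cexp (-κ * z.1) - 1) * g z.1) * ((cexp (κ * z.2) - 1) * f z.2)) := by
    intro z
    rw [kernelTerm_eq hκ]
    simp only [neg_mul]
    ring
  simp_rw [hpt]
  rw [integral_const_mul]
  congr 1
  have hI1 : Integrable (fun z : ℝ × ℝ ↦ ((cexp (κ * z.1) - 1) * g z.1) * ((cexp (-κ * z.2) - 1) * f z.2))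
      ((volume.restrict (Ioo (-a) a)).prod (volume.restrict (Ioo (-a) a))) :=
    (integrable_exp_sub_one_mul κ hg).mul_prod (integrable_exp_sub_one_mul (-κ) hf)
  have hI2 : Integrable (fun z : ℝ × ℝ ↦ ((cexp (-κ * z.1) - 1) * g z.1) * ((cexp (κ * z.2) - 1) * f z.2))
      ((volume.restrict (Ioo (-a) a)).prod (volume.restrict (Ioo (-a) a))) :=
    (integrable_exp_sub_one_mul (-κ) hg).mul_prod (integrable_exp_sub_one_mul κ hf)
  rw [integral_add hI1 hI2]
  rw [integral_prod_mul (μ := volume.restrict (Ioo (-a) a)) (ν := volume.restrict (Ioo (-a) a))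
      (fun t : ℝ ↦ (cexp (κ * t) - 1) * g t) (fun u : ℝ ↦ (cexp (-κ * u) - 1) * f u),
    integral_prod_mul (μ := volume.restrict (Ioo (-a) a)) (ν := volume.restrict (Ioo (-a) a))
      (fun t : ℝ ↦ (cexp (-κ * t) - 1) * g t) (fun u : ℝ ↦ (cexp (κ * u) - 1) * f u)]

/-! ### Step 2. `⟨φ,φ⟩_{G_g,a}` as an integral over the square, and as the series of Step-1 terms -/

/-- `‖cosh w‖ ≤ cosh (Re w)` (copy of the private bound of `ZetaScrewProp31Proofs`). [folklore] -/
private theorem norm_cosh_le (w : ℂ) : ‖Complex.cosh w‖ ≤ Real.cosh w.re := by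
  rw [Complex.cosh, Real.cosh_eq]
  have h2 : ‖(cexp w + cexp (-w)) / 2‖ = ‖cexp w + cexp (-w)‖ / 2 := by
    rw [norm_div]; norm_num
  rw [h2]
  gcongr
  calc ‖cexp w + cexp (-w)‖ ≤ ‖cexp w‖ + ‖cexp (-w)‖ := norm_add_le _ _
    _ = Real.exp w.re + Real.exp (-w.re) := by rw [Complex.norm_exp, Complex.norm_exp, neg_re]

/-- `‖c_ρ(x)‖ ≤ (cosh a + 1)/‖ρ − 1/2‖²` for `|x| ≤ 2a` (copy of the private bound of
`ZetaScrewProp31Proofs`). [folklore] -/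
private theorem norm_cTerm_le (ρ : ZetaZeros.riemannZetaNontrivialZeros) {x a : ℝ} (hx : |x| ≤ 2 * a) :
    ‖((Complex.cosh (((ρ : ℂ) - 1 / 2) * (x : ℂ)) - 1) / ((ρ : ℂ) - 1 / 2) ^ 2)‖ ≤
      (Real.cosh a + 1) / ‖(ρ : ℂ) - 1 / 2‖ ^ 2 := by
  rw [norm_div, norm_pow]
  refine div_le_div_of_nonneg_right ?_ (by positivity)
  have h0 := ZetaZeros.riemannZetaNontrivialZeros.re_pos ρ.2
  have h1 := ZetaZeros.riemannZetaNontrivialZeros.re_lt_one ρ.2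
  calc ‖Complex.cosh (((ρ : ℂ) - 1 / 2) * x) - 1‖
      ≤ ‖Complex.cosh (((ρ : ℂ) - 1 / 2) * x)‖ + ‖(1 : ℂ)‖ := norm_sub_le _ _
    _ ≤ Real.cosh ((((ρ : ℂ) - 1 / 2) * x).re) + 1 := by
        rw [norm_one]; linarith [norm_cosh_le (((ρ : ℂ) - 1 / 2) * x)]
    _ ≤ Real.cosh a + 1 := by
        suffices h : Real.cosh ((((ρ : ℂ) - 1 / 2) * x).re) ≤ Real.cosh a by linarith
        refine Real.cosh_le_cosh.mpr ?_
        have hre : ((((ρ : ℂ) - 1 / 2) * x).re) = ((ρ : ℂ).re - 1 / 2) * x := by simp [mul_re]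
        rw [hre, abs_mul]
        have ha : 0 ≤ a := by linarith [abs_nonneg x]
        have hρ : |(ρ : ℂ).re - 1 / 2| ≤ 1 / 2 := by rw [abs_le]; constructor <;> linarith
        calc |(ρ : ℂ).re - 1 / 2| * |x| ≤ (1 / 2) * (2 * a) :=
              mul_le_mul hρ hx (abs_nonneg _) (by norm_num)
          _ = |a| := by rw [abs_of_nonneg ha]; ring

/-- `ρ − 1/2 ≠ 0` for a non-trivial zero (the zeros are off the real axis). [folklore] -/
private theorem sub_half_ne_zero (ρ : ZetaZeros.riemannZetaNontrivialZeros) : (ρ : ℂ) - 1 / 2 ≠ 0 := by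
  intro h
  have him := ZetaZeros.riemannZetaNontrivialZeros.im_ne_zero ρ.2
  have : ((ρ : ℂ) - 1 / 2).im = 0 := by rw [h]; simp
  simp at this
  exact him this

/-- `x ↦ (cosh κx − 1)/κ²` is continuous. [folklore] -/
private theorem continuous_cTerm (κ : ℂ) :
    Continuous fun x : ℝ ↦ (Complex.cosh (κ * (x : ℂ)) - 1) / κ ^ 2 :=
  ((Complex.continuous_cosh.comp (continuous_const.mul continuous_ofReal)).sub
    continuous_const).div_const _

/-- The kernel `G_g` is jointly continuous. [folklore] -/
private theorem continuous_zetaScrewKernel_uncurry :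
    Continuous fun z : ℝ × ℝ ↦ zetaScrewKernel z.1 z.2 := by
  unfold zetaScrewKernel
  exact ((continuous_zetaScrew.comp continuous_fst).add
    (continuous_zetaScrew.comp continuous_snd)).sub
      (continuous_zetaScrew.comp (continuous_fst.sub continuous_snd))

/-- a.e. on the square both coordinates lie in `(−a, a)`. [folklore] -/
private theorem ae_mem_sq : ∀ᵐ z ∂((volume.restrict (Ioo (-a) a)).prod (volume.restrict (Ioo (-a) a))),
    z ∈ Ioo (-a) a ×ˢ Ioo (-a) a := by
  rw [Measure.prod_restrict]
  exact ae_restrict_mem (measurableSet_Ioo.prod measurableSet_Ioo)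

/-- `(t,u) ↦ φ₁(u) conj φ₂(t)` is integrable on the square for `φ₁, φ₂ ∈ L¹(−a,a)`. [folklore] -/
private theorem integrable_mul_conj {φ₁ φ₂ : ℝ → ℂ}
    (hφ₁ : Integrable φ₁ (volume.restrict (Ioo (-a) a)))
    (hφ₂ : Integrable φ₂ (volume.restrict (Ioo (-a) a))) :
    Integrable (fun z : ℝ × ℝ ↦ φ₁ z.2 * conj (φ₂ z.1))
      ((volume.restrict (Ioo (-a) a)).prod (volume.restrict (Ioo (-a) a))) := by
  have hc : Integrable (fun t ↦ conj (φ₂ t)) (volume.restrict (Ioo (-a) a)) :=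
    (LinearIsometryEquiv.integrable_comp_iff Complex.conjLIE).mpr hφ₂
  exact (hc.mul_prod hφ₁).congr (Eventually.of_forall fun z ↦ mul_comm _ _)

/-- **(1.10) on the square**: for `φ₁, φ₂ ∈ L¹(−a,a)`,
`⟨φ₁,φ₂⟩_{G_g,a} = ∫_{(−a,a)²} G_g(t,u) φ₁(u) conj φ₂(t)` (Fubini; the kernel is continuous, hence
bounded, on the square, so (1.10) converges absolutely for `φ₁, φ₂ ∈ L¹`). [cite: Suzuki2023, (1.10), p. 3] -/
theorem zetaScrewForm_eq_integral_prod {φ₁ φ₂ : ℝ → ℂ}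
    (hφ₁ : Integrable φ₁ (volume.restrict (Ioo (-a) a)))
    (hφ₂ : Integrable φ₂ (volume.restrict (Ioo (-a) a))) :
    zetaScrewForm (Ioo (-a) a) φ₁ φ₂ =
      ∫ z, (zetaScrewKernel z.1 z.2 : ℂ) * φ₁ z.2 * conj (φ₂ z.1)
        ∂((volume.restrict (Ioo (-a) a)).prod (volume.restrict (Ioo (-a) a))) := by
  obtain ⟨C, hC⟩ := (isCompact_Icc.prod isCompact_Icc :
      IsCompact (Icc (-a) a ×ˢ Icc (-a) a)).exists_bound_of_continuousOn
    (continuous_ofReal.comp continuous_zetaScrewKernel_uncurry).continuousOn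
  have hint : Integrable (fun z : ℝ × ℝ ↦
      (zetaScrewKernel z.1 z.2 : ℂ) * φ₁ z.2 * conj (φ₂ z.1))
      ((volume.restrict (Ioo (-a) a)).prod (volume.restrict (Ioo (-a) a))) := by
    have h := (integrable_mul_conj hφ₁ hφ₂).bdd_mul
      (continuous_ofReal.comp continuous_zetaScrewKernel_uncurry).aestronglyMeasurable
      (ae_mem_sq.mono fun z hz ↦ hC z ⟨Ioo_subset_Icc_self hz.1, Ioo_subset_Icc_self hz.2⟩)
    exact h.congr (Eventually.of_forall fun z ↦ by simp only [Function.comp]; ring)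
  rw [integral_prod _ hint]
  rfl

/-- **(1.9) integrated termwise** (dominated convergence, majorant
`3(cosh a + 1) m(ρ)/‖ρ − 1/2‖² · |φ₁(u)||φ₂(t)|`): for `φ₁, φ₂ ∈ L¹(−a,a)` the terms of (1.9)
against `φ₁(u) conj φ₂(t)` sum to `∫_{(−a,a)²} G_g(t,u) φ₁(u) conj φ₂(t)`. [cite: Suzuki2023, §3.1 eq. (3.1), p. 7] -/
theorem hasSum_integral_term {φ₁ φ₂ : ℝ → ℂ}
    (hφ₁ : Integrable φ₁ (volume.restrict (Ioo (-a) a)))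
    (hφ₂ : Integrable φ₂ (volume.restrict (Ioo (-a) a))) :
    HasSum (fun ρ : ZetaZeros.riemannZetaNontrivialZeros ↦
      ∫ z, (riemannZetaZeroOrder (ρ : ℂ) : ℂ) *
        (((Complex.cosh (((ρ : ℂ) - 1 / 2) * (z.1 : ℂ)) - 1) / ((ρ : ℂ) - 1 / 2) ^ 2) + ((Complex.cosh (((ρ : ℂ) - 1 / 2) * (z.2 : ℂ)) - 1) / ((ρ : ℂ) - 1 / 2) ^ 2) - ((Complex.cosh (((ρ : ℂ) - 1 / 2) * ((z.1 - z.2 : ℝ) : ℂ)) - 1) / ((ρ : ℂ) - 1 / 2) ^ 2)) * φ₁ z.2 * conj (φ₂ z.1)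
        ∂((volume.restrict (Ioo (-a) a)).prod (volume.restrict (Ioo (-a) a))))
      (∫ z, (zetaScrewKernel z.1 z.2 : ℂ) * φ₁ z.2 * conj (φ₂ z.1)
        ∂((volume.restrict (Ioo (-a) a)).prod (volume.restrict (Ioo (-a) a)))) := by
  haveI : Countable ZetaZeros.riemannZetaNontrivialZeros :=
    riemannZetaNontrivialZeros_countable.to_subtype
  set C : ℝ := Real.cosh a + 1 with hC
  have hC0 : 0 ≤ C := by positivity
  have hφc : AEStronglyMeasurable (fun t ↦ conj (φ₂ t)) (volume.restrict (Ioo (-a) a)) :=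
    ((LinearIsometryEquiv.integrable_comp_iff Complex.conjLIE).mpr hφ₂).aestronglyMeasurable
  have hF_meas : ∀ ρ : ZetaZeros.riemannZetaNontrivialZeros, AEStronglyMeasurable
      (fun z : ℝ × ℝ ↦ (riemannZetaZeroOrder (ρ : ℂ) : ℂ) *
        (((Complex.cosh (((ρ : ℂ) - 1 / 2) * (z.1 : ℂ)) - 1) / ((ρ : ℂ) - 1 / 2) ^ 2) + ((Complex.cosh (((ρ : ℂ) - 1 / 2) * (z.2 : ℂ)) - 1) / ((ρ : ℂ) - 1 / 2) ^ 2) - ((Complex.cosh (((ρ : ℂ) - 1 / 2) * ((z.1 - z.2 : ℝ) : ℂ)) - 1) / ((ρ : ℂ) - 1 / 2) ^ 2)) * φ₁ z.2 * conj (φ₂ z.1))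
      ((volume.restrict (Ioo (-a) a)).prod (volume.restrict (Ioo (-a) a))) := by
    intro ρ
    have hc : Continuous fun z : ℝ × ℝ ↦ ((Complex.cosh (((ρ : ℂ) - 1 / 2) * (z.1 : ℂ)) - 1) / ((ρ : ℂ) - 1 / 2) ^ 2) + ((Complex.cosh (((ρ : ℂ) - 1 / 2) * (z.2 : ℂ)) - 1) / ((ρ : ℂ) - 1 / 2) ^ 2) - ((Complex.cosh (((ρ : ℂ) - 1 / 2) * ((z.1 - z.2 : ℝ) : ℂ)) - 1) / ((ρ : ℂ) - 1 / 2) ^ 2) :=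
      (((continuous_cTerm _).comp continuous_fst).add ((continuous_cTerm _).comp continuous_snd)).sub
        ((continuous_cTerm _).comp (continuous_fst.sub continuous_snd))
    have h2 : AEStronglyMeasurable (fun z : ℝ × ℝ ↦ φ₁ z.2)
        ((volume.restrict (Ioo (-a) a)).prod (volume.restrict (Ioo (-a) a))) :=
      hφ₁.aestronglyMeasurable.comp_snd
    have h1 : AEStronglyMeasurable (fun z : ℝ × ℝ ↦ conj (φ₂ z.1))
        ((volume.restrict (Ioo (-a) a)).prod (volume.restrict (Ioo (-a) a))) :=
      hφc.comp_fst
    exact (((continuous_const.mul hc).aestronglyMeasurable).mul h2).mul h1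
  have h_bound : ∀ ρ : ZetaZeros.riemannZetaNontrivialZeros,
      ∀ᵐ z ∂((volume.restrict (Ioo (-a) a)).prod (volume.restrict (Ioo (-a) a))),
        ‖(riemannZetaZeroOrder (ρ : ℂ) : ℂ) *
          (((Complex.cosh (((ρ : ℂ) - 1 / 2) * (z.1 : ℂ)) - 1) / ((ρ : ℂ) - 1 / 2) ^ 2) + ((Complex.cosh (((ρ : ℂ) - 1 / 2) * (z.2 : ℂ)) - 1) / ((ρ : ℂ) - 1 / 2) ^ 2) - ((Complex.cosh (((ρ : ℂ) - 1 / 2) * ((z.1 - z.2 : ℝ) : ℂ)) - 1) / ((ρ : ℂ) - 1 / 2) ^ 2)) * φ₁ z.2 * conj (φ₂ z.1)‖ ≤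
        3 * C * ((riemannZetaZeroOrder (ρ : ℂ) : ℝ) / ‖(ρ : ℂ) - 1 / 2‖ ^ 2) * (‖φ₁ z.2‖ * ‖φ₂ z.1‖) := by
    intro ρ
    refine ae_mem_sq.mono fun z hz ↦ ?_
    have h1l : -a < z.1 := hz.1.1
    have h1r : z.1 < a := hz.1.2
    have h2l : -a < z.2 := hz.2.1
    have h2r : z.2 < a := hz.2.2
    have ht := abs_le.mpr (And.intro (by linarith : -(2 * a) ≤ z.1) (by linarith : z.1 ≤ 2 * a))
    have hu := abs_le.mpr (And.intro (by linarith : -(2 * a) ≤ z.2) (by linarith : z.2 ≤ 2 * a))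
    have htu := abs_le.mpr
      (And.intro (by linarith : -(2 * a) ≤ z.1 - z.2) (by linarith : z.1 - z.2 ≤ 2 * a))
    have hm : (0 : ℝ) ≤ riemannZetaZeroOrder (ρ : ℂ) := ZetaZeroSum.zeroOrder_nonneg ρ
    have hmn : ‖(riemannZetaZeroOrder (ρ : ℂ) : ℂ)‖ = (riemannZetaZeroOrder (ρ : ℂ) : ℝ) := by
      rw [Complex.norm_intCast, abs_of_nonneg hm]
    have hc3 : ‖((Complex.cosh (((ρ : ℂ) - 1 / 2) * (z.1 : ℂ)) - 1) / ((ρ : ℂ) - 1 / 2) ^ 2) + ((Complex.cosh (((ρ : ℂ) - 1 / 2) * (z.2 : ℂ)) - 1) / ((ρ : ℂ) - 1 / 2) ^ 2) - ((Complex.cosh (((ρ : ℂ) - 1 / 2) * ((z.1 - z.2 : ℝ) : ℂ)) - 1) / ((ρ : ℂ) - 1 / 2) ^ 2)‖ ≤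
        3 * (C / ‖(ρ : ℂ) - 1 / 2‖ ^ 2) := by
      have e1 := norm_cTerm_le ρ ht
      have e2 := norm_cTerm_le ρ hu
      have e3 := norm_cTerm_le ρ htu
      calc ‖((Complex.cosh (((ρ : ℂ) - 1 / 2) * (z.1 : ℂ)) - 1) / ((ρ : ℂ) - 1 / 2) ^ 2) + ((Complex.cosh (((ρ : ℂ) - 1 / 2) * (z.2 : ℂ)) - 1) / ((ρ : ℂ) - 1 / 2) ^ 2) - ((Complex.cosh (((ρ : ℂ) - 1 / 2) * ((z.1 - z.2 : ℝ) : ℂ)) - 1) / ((ρ : ℂ) - 1 / 2) ^ 2)‖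
          ≤ ‖((Complex.cosh (((ρ : ℂ) - 1 / 2) * (z.1 : ℂ)) - 1) / ((ρ : ℂ) - 1 / 2) ^ 2) + ((Complex.cosh (((ρ : ℂ) - 1 / 2) * (z.2 : ℂ)) - 1) / ((ρ : ℂ) - 1 / 2) ^ 2)‖ + ‖((Complex.cosh (((ρ : ℂ) - 1 / 2) * ((z.1 - z.2 : ℝ) : ℂ)) - 1) / ((ρ : ℂ) - 1 / 2) ^ 2)‖ := norm_sub_le _ _
        _ ≤ (‖((Complex.cosh (((ρ : ℂ) - 1 / 2) * (z.1 : ℂ)) - 1) / ((ρ : ℂ) - 1 / 2) ^ 2)‖ + ‖((Complex.cosh (((ρ : ℂ) - 1 / 2) * (z.2 : ℂ)) - 1) / ((ρ : ℂ) - 1 / 2) ^ 2)‖) + ‖((Complex.cosh (((ρ : ℂ) - 1 / 2) * ((z.1 - z.2 : ℝ) : ℂ)) - 1) / ((ρ : ℂ) - 1 / 2) ^ 2)‖ := by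
            gcongr; exact norm_add_le _ _
        _ ≤ (C / ‖(ρ : ℂ) - 1 / 2‖ ^ 2 + C / ‖(ρ : ℂ) - 1 / 2‖ ^ 2) + C / ‖(ρ : ℂ) - 1 / 2‖ ^ 2 := by
            gcongr
        _ = 3 * (C / ‖(ρ : ℂ) - 1 / 2‖ ^ 2) := by ring
    calc ‖(riemannZetaZeroOrder (ρ : ℂ) : ℂ) *
          (((Complex.cosh (((ρ : ℂ) - 1 / 2) * (z.1 : ℂ)) - 1) / ((ρ : ℂ) - 1 / 2) ^ 2) + ((Complex.cosh (((ρ : ℂ) - 1 / 2) * (z.2 : ℂ)) - 1) / ((ρ : ℂ) - 1 / 2) ^ 2) - ((Complex.cosh (((ρ : ℂ) - 1 / 2) * ((z.1 - z.2 : ℝ) : ℂ)) - 1) / ((ρ : ℂ) - 1 / 2) ^ 2)) * φ₁ z.2 * conj (φ₂ z.1)‖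
        = (riemannZetaZeroOrder (ρ : ℂ) : ℝ) * ‖((Complex.cosh (((ρ : ℂ) - 1 / 2) * (z.1 : ℂ)) - 1) / ((ρ : ℂ) - 1 / 2) ^ 2) + ((Complex.cosh (((ρ : ℂ) - 1 / 2) * (z.2 : ℂ)) - 1) / ((ρ : ℂ) - 1 / 2) ^ 2) - ((Complex.cosh (((ρ : ℂ) - 1 / 2) * ((z.1 - z.2 : ℝ) : ℂ)) - 1) / ((ρ : ℂ) - 1 / 2) ^ 2)‖ *
            ‖φ₁ z.2‖ * ‖φ₂ z.1‖ := by
          rw [norm_mul, norm_mul, norm_mul, hmn, Complex.norm_conj]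
      _ ≤ (riemannZetaZeroOrder (ρ : ℂ) : ℝ) * (3 * (C / ‖(ρ : ℂ) - 1 / 2‖ ^ 2)) * ‖φ₁ z.2‖ * ‖φ₂ z.1‖ := by
          gcongr
      _ = 3 * C * ((riemannZetaZeroOrder (ρ : ℂ) : ℝ) / ‖(ρ : ℂ) - 1 / 2‖ ^ 2) * (‖φ₁ z.2‖ * ‖φ₂ z.1‖) := by
          ring
  have bound_summable : ∀ᵐ z ∂((volume.restrict (Ioo (-a) a)).prod (volume.restrict (Ioo (-a) a))),
      Summable fun ρ : ZetaZeros.riemannZetaNontrivialZeros ↦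
        3 * C * ((riemannZetaZeroOrder (ρ : ℂ) : ℝ) / ‖(ρ : ℂ) - 1 / 2‖ ^ 2) * (‖φ₁ z.2‖ * ‖φ₂ z.1‖) :=
    Eventually.of_forall fun z ↦
      (summable_zeroOrder_div_norm_sub_half_sq.mul_left (3 * C)).mul_right _
  have bound_integrable : Integrable (fun z : ℝ × ℝ ↦
      ∑' ρ : ZetaZeros.riemannZetaNontrivialZeros,
        3 * C * ((riemannZetaZeroOrder (ρ : ℂ) : ℝ) / ‖(ρ : ℂ) - 1 / 2‖ ^ 2) * (‖φ₁ z.2‖ * ‖φ₂ z.1‖))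
      ((volume.restrict (Ioo (-a) a)).prod (volume.restrict (Ioo (-a) a))) := by
    simp_rw [tsum_mul_right]
    refine Integrable.const_mul ?_ _
    exact (hφ₂.norm.mul_prod hφ₁.norm).congr (Eventually.of_forall fun z ↦ mul_comm _ _)
  have h_lim : ∀ᵐ z ∂((volume.restrict (Ioo (-a) a)).prod (volume.restrict (Ioo (-a) a))),
      HasSum (fun ρ : ZetaZeros.riemannZetaNontrivialZeros ↦ (riemannZetaZeroOrder (ρ : ℂ) : ℂ) *
        (((Complex.cosh (((ρ : ℂ) - 1 / 2) * (z.1 : ℂ)) - 1) / ((ρ : ℂ) - 1 / 2) ^ 2) + ((Complex.cosh (((ρ : ℂ) - 1 / 2) * (z.2 : ℂ)) - 1) / ((ρ : ℂ) - 1 / 2) ^ 2) - ((Complex.cosh (((ρ : ℂ) - 1 / 2) * ((z.1 - z.2 : ℝ) : ℂ)) - 1) / ((ρ : ℂ) - 1 / 2) ^ 2)) * φ₁ z.2 * conj (φ₂ z.1))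
        ((zetaScrewKernel z.1 z.2 : ℂ) * φ₁ z.2 * conj (φ₂ z.1)) :=
    Eventually.of_forall fun z ↦
      ((hasSum_zetaScrewKernel z.1 z.2).mul_right (φ₁ z.2)).mul_right (conj (φ₂ z.1))
  exact hasSum_integral_of_dominated_convergence _ hF_meas h_bound bound_summable
    bound_integrable h_lim


/-- **(3.1) on `L¹(−a,a) ⊃ L²(−a,a)`, unconditionally**: for `φ₁, φ₂` integrable on `(−a,a)`,
`⟨φ₁,φ₂⟩_{G_g,a} = Σ_ρ m(ρ)·(−(2κ_ρ²)⁻¹)[D_{φ̄₂}(κ_ρ)D_{φ₁}(−κ_ρ) + D_{φ̄₂}(−κ_ρ)D_{φ₁}(κ_ρ)]`,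
`κ_ρ = ρ − 1/2`, `D_h(s) = ∫_{−a}^{a}(e^{su} − 1)h(u)du`, summed over the distinct zeros `ρ` with
multiplicity `m(ρ)`. Dictionary with the source: `γ = iκ_ρ` is a zero of `ξ(1/2 − iz)`,
`D_{φ₁}(κ_ρ) = φ̂₁(−γ) − φ̂₁(0)`, `D_{φ̄₂}(−κ_ρ) = (φ̄₂)^(γ) − (φ̄₂)^(0)`, `−κ_ρ⁻² = γ⁻²`; the two
summands are the terms of (3.1) at `γ` and at `−γ` (i.e. at `ρ` and `1 − ρ`), each taken with
weight `1/2` — the same symmetric pairing as in `ZetaScrewProp31.hasSum_term`. [cite: Suzuki2023, §3.1 eq. (3.1), p. 7] -/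
theorem hasSum_zetaScrewForm {φ₁ φ₂ : ℝ → ℂ}
    (hφ₁ : Integrable φ₁ (volume.restrict (Ioo (-a) a)))
    (hφ₂ : Integrable φ₂ (volume.restrict (Ioo (-a) a))) :
    HasSum (fun ρ : ZetaZeros.riemannZetaNontrivialZeros ↦
      (riemannZetaZeroOrder (ρ : ℂ) : ℂ) * (-(2 * ((ρ : ℂ) - 1 / 2) ^ 2)⁻¹ *
        ((∫ t, (cexp (((ρ : ℂ) - 1 / 2) * t) - 1) * conj (φ₂ t) ∂(volume.restrict (Ioo (-a) a))) *
            (∫ u, (cexp (-((ρ : ℂ) - 1 / 2) * u) - 1) * φ₁ u ∂(volume.restrict (Ioo (-a) a))) +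
          (∫ t, (cexp (-((ρ : ℂ) - 1 / 2) * t) - 1) * conj (φ₂ t) ∂(volume.restrict (Ioo (-a) a))) *
            (∫ u, (cexp (((ρ : ℂ) - 1 / 2) * u) - 1) * φ₁ u ∂(volume.restrict (Ioo (-a) a))))))
      (zetaScrewForm (Ioo (-a) a) φ₁ φ₂) := by
  have hφc : Integrable (fun t ↦ conj (φ₂ t)) (volume.restrict (Ioo (-a) a)) :=
    (LinearIsometryEquiv.integrable_comp_iff Complex.conjLIE).mpr hφ₂
  have h := hasSum_integral_term hφ₁ hφ₂
  rw [← zetaScrewForm_eq_integral_prod hφ₁ hφ₂] at h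
  refine h.congr_fun fun ρ ↦ ?_
  have hmul : ∀ z : ℝ × ℝ, (riemannZetaZeroOrder (ρ : ℂ) : ℂ) *
        (((Complex.cosh (((ρ : ℂ) - 1 / 2) * (z.1 : ℂ)) - 1) / ((ρ : ℂ) - 1 / 2) ^ 2) + ((Complex.cosh (((ρ : ℂ) - 1 / 2) * (z.2 : ℂ)) - 1) / ((ρ : ℂ) - 1 / 2) ^ 2) - ((Complex.cosh (((ρ : ℂ) - 1 / 2) * ((z.1 - z.2 : ℝ) : ℂ)) - 1) / ((ρ : ℂ) - 1 / 2) ^ 2)) * φ₁ z.2 * conj (φ₂ z.1) =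
      (riemannZetaZeroOrder (ρ : ℂ) : ℂ) *
        ((((Complex.cosh (((ρ : ℂ) - 1 / 2) * (z.1 : ℂ)) - 1) / ((ρ : ℂ) - 1 / 2) ^ 2) + ((Complex.cosh (((ρ : ℂ) - 1 / 2) * (z.2 : ℂ)) - 1) / ((ρ : ℂ) - 1 / 2) ^ 2) - ((Complex.cosh (((ρ : ℂ) - 1 / 2) * ((z.1 - z.2 : ℝ) : ℂ)) - 1) / ((ρ : ℂ) - 1 / 2) ^ 2)) * φ₁ z.2 * conj (φ₂ z.1)) := by
    intro z; ring
  simp_rw [hmul]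
  rw [integral_const_mul, integral_kernelTerm_mul (sub_half_ne_zero ρ) hφ₁ hφc]

/-! ### Step 3. Under RH every term is a non-negative real number -/

/-- Under RH every non-trivial zero has real part `1/2`. [folklore] -/
private theorem re_eq_half_of_RH (hRH : RiemannHypothesis) (ρ : ZetaZeros.riemannZetaNontrivialZeros) :
    (ρ : ℂ).re = 1 / 2 := by
  refine hRH ρ (ZetaZeros.riemannZetaNontrivialZeros.zeta_eq_zero ρ.2) ?_
    (ZetaZeros.riemannZetaNontrivialZeros.ne_one ρ.2)
  rintro ⟨n, hn⟩
  have h0 := ZetaZeros.riemannZetaNontrivialZeros.re_pos ρ.2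
  rw [hn] at h0
  simp at h0
  linarith

/-- Under RH, `conj κ_ρ = −κ_ρ` (`κ_ρ = ρ − 1/2 = i Im ρ`). [folklore] -/
private theorem conj_kappa (hRH : RiemannHypothesis) (ρ : ZetaZeros.riemannZetaNontrivialZeros) :
    conj ((ρ : ℂ) - 1 / 2) = -((ρ : ℂ) - 1 / 2) := by
  have h := re_eq_half_of_RH hRH ρ
  apply Complex.ext
  · simp [h]
  · simp

/-- Under RH, `κ_ρ² = −(Im ρ)²`. [folklore] -/
private theorem kappa_sq (hRH : RiemannHypothesis) (ρ : ZetaZeros.riemannZetaNontrivialZeros) :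
    ((ρ : ℂ) - 1 / 2) ^ 2 = -(((ρ : ℂ).im ^ 2 : ℝ) : ℂ) := by
  have h : (ρ : ℂ) - 1 / 2 = ((ρ : ℂ).im : ℂ) * I :=
    Complex.ext (by simp [re_eq_half_of_RH hRH ρ]) (by simp)
  rw [h, mul_pow, Complex.I_sq]
  push_cast
  ring

/-- Conjugating an exponential moment: `∫ (e^{s̄t} − 1) conj φ(t) = conj ∫ (e^{st} − 1) φ(t)`. [folklore] -/
private theorem integral_exp_sub_one_mul_conj (s : ℂ) (φ : ℝ → ℂ) (μ : Measure ℝ) :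
    ∫ t, (cexp (conj s * t) - 1) * conj (φ t) ∂μ = conj (∫ t, (cexp (s * t) - 1) * φ t ∂μ) := by
  rw [← integral_conj]
  congr 1
  funext t
  rw [map_mul, map_sub, map_one, ← Complex.exp_conj, map_mul, Complex.conj_ofReal]

/-- **Step 3**: under RH, the `ρ`-th term of the series for `⟨φ,φ⟩_{G_g,a}` is the non-negative
real number `m(ρ)(|D_φ(κ_ρ)|² + |D_φ(−κ_ρ)|²)/(2 (Im ρ)²)`, `D_φ(s) = ∫_{−a}^{a}(e^{su} − 1)φ(u) du`
(the two factors of (3.1)–(3.2) are complex conjugate when `γ` is real). [cite: Suzuki2023, §3.1 (3.2), p. 7] -/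
theorem integral_term_of_RH (hRH : RiemannHypothesis) (ρ : ZetaZeros.riemannZetaNontrivialZeros)
    {φ : ℝ → ℂ} (hφ : Integrable φ (volume.restrict (Ioo (-a) a))) :
    ∫ z, (riemannZetaZeroOrder (ρ : ℂ) : ℂ) *
        (((Complex.cosh (((ρ : ℂ) - 1 / 2) * (z.1 : ℂ)) - 1) / ((ρ : ℂ) - 1 / 2) ^ 2) + ((Complex.cosh (((ρ : ℂ) - 1 / 2) * (z.2 : ℂ)) - 1) / ((ρ : ℂ) - 1 / 2) ^ 2) - ((Complex.cosh (((ρ : ℂ) - 1 / 2) * ((z.1 - z.2 : ℝ) : ℂ)) - 1) / ((ρ : ℂ) - 1 / 2) ^ 2)) * φ z.2 * conj (φ z.1)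
        ∂((volume.restrict (Ioo (-a) a)).prod (volume.restrict (Ioo (-a) a))) =
      (((riemannZetaZeroOrder (ρ : ℂ) : ℝ) *
          (‖∫ u, (cexp (((ρ : ℂ) - 1 / 2) * u) - 1) * φ u ∂(volume.restrict (Ioo (-a) a))‖ ^ 2 +
            ‖∫ u, (cexp (-((ρ : ℂ) - 1 / 2) * u) - 1) * φ u ∂(volume.restrict (Ioo (-a) a))‖ ^ 2) /
          (2 * (ρ : ℂ).im ^ 2) : ℝ) : ℂ) := by
  have hφc : Integrable (fun t ↦ conj (φ t)) (volume.restrict (Ioo (-a) a)) :=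
    (LinearIsometryEquiv.integrable_comp_iff Complex.conjLIE).mpr hφ
  have hmul : ∀ z : ℝ × ℝ, (riemannZetaZeroOrder (ρ : ℂ) : ℂ) *
        (((Complex.cosh (((ρ : ℂ) - 1 / 2) * (z.1 : ℂ)) - 1) / ((ρ : ℂ) - 1 / 2) ^ 2) + ((Complex.cosh (((ρ : ℂ) - 1 / 2) * (z.2 : ℂ)) - 1) / ((ρ : ℂ) - 1 / 2) ^ 2) - ((Complex.cosh (((ρ : ℂ) - 1 / 2) * ((z.1 - z.2 : ℝ) : ℂ)) - 1) / ((ρ : ℂ) - 1 / 2) ^ 2)) * φ z.2 * conj (φ z.1) =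
      (riemannZetaZeroOrder (ρ : ℂ) : ℂ) *
        ((((Complex.cosh (((ρ : ℂ) - 1 / 2) * (z.1 : ℂ)) - 1) / ((ρ : ℂ) - 1 / 2) ^ 2) + ((Complex.cosh (((ρ : ℂ) - 1 / 2) * (z.2 : ℂ)) - 1) / ((ρ : ℂ) - 1 / 2) ^ 2) - ((Complex.cosh (((ρ : ℂ) - 1 / 2) * ((z.1 - z.2 : ℝ) : ℂ)) - 1) / ((ρ : ℂ) - 1 / 2) ^ 2)) * φ z.2 * conj (φ z.1)) := by
    intro z; ring
  simp_rw [hmul]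
  rw [integral_const_mul, integral_kernelTerm_mul (sub_half_ne_zero ρ) hφ hφc]
  have hk := conj_kappa hRH ρ
  have e1 : ∫ t, (cexp (((ρ : ℂ) - 1 / 2) * t) - 1) * conj (φ t) ∂(volume.restrict (Ioo (-a) a)) =
      conj (∫ t, (cexp (-((ρ : ℂ) - 1 / 2) * t) - 1) * φ t ∂(volume.restrict (Ioo (-a) a))) := by
    rw [← integral_exp_sub_one_mul_conj, map_neg, hk, neg_neg]
  have e2 : ∫ t, (cexp (-((ρ : ℂ) - 1 / 2) * t) - 1) * conj (φ t) ∂(volume.restrict (Ioo (-a) a)) =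
      conj (∫ t, (cexp (((ρ : ℂ) - 1 / 2) * t) - 1) * φ t ∂(volume.restrict (Ioo (-a) a))) := by
    rw [← integral_exp_sub_one_mul_conj, hk]
  rw [e1, e2, Complex.conj_mul', Complex.conj_mul', kappa_sq hRH ρ]
  have hτ : ((ρ : ℂ).im : ℂ) ≠ 0 :=
    Complex.ofReal_ne_zero.mpr (ZetaZeros.riemannZetaNontrivialZeros.im_ne_zero ρ.2)
  push_cast
  field_simp
  ring

/-! ### Step 4. The exponential moments `D_φ(s) = ∫ (e^{su} − 1) φ(u) du` form an entire function of exponential type -/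

/-- Differentiation under the integral sign. [folklore] -/
private theorem hasDerivAt_expMoment {φ : ℝ → ℂ}
    (hφ : Integrable φ (volume.restrict (Ioo (-a) a))) (s₀ : ℂ) :
    HasDerivAt (fun s : ℂ ↦ ∫ u, (cexp (s * u) - 1) * φ u ∂(volume.restrict (Ioo (-a) a)))
      (∫ u, cexp (s₀ * u) * u * φ u ∂(volume.restrict (Ioo (-a) a))) s₀ := by
  have ha0 : 0 ≤ |a| := abs_nonneg a
  refine (hasDerivAt_integral_of_dominated_loc_of_deriv_le (μ := volume.restrict (Ioo (-a) a))
    (F := fun s u ↦ (cexp (s * u) - 1) * φ u) (F' := fun s u ↦ cexp (s * u) * u * φ u)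
    (x₀ := s₀) (bound := fun u ↦ |a| * Real.exp ((‖s₀‖ + 1) * |a|) * ‖φ u‖)
    (Metric.ball_mem_nhds s₀ zero_lt_one) ?_ ?_ ?_ ?_ ?_ ?_).2
  · exact Eventually.of_forall fun s ↦ (integrable_exp_sub_one_mul s hφ).aestronglyMeasurable
  · exact integrable_exp_sub_one_mul s₀ hφ
  · exact (Continuous.aestronglyMeasurable (by fun_prop)).mul hφ.aestronglyMeasurable
  · refine ae_abs_le.mono fun u hu s hs ↦ ?_
    have hs' : ‖s‖ ≤ ‖s₀‖ + 1 := by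
      have := mem_ball_iff_norm.mp hs
      linarith [norm_le_norm_add_norm_sub' s s₀, norm_sub_rev s s₀]
    have hu' : |u| ≤ |a| := hu.trans (le_abs_self a)
    rw [norm_mul, norm_mul, Complex.norm_real, Real.norm_eq_abs, Complex.norm_exp]
    have hre : (s * u).re ≤ (‖s₀‖ + 1) * |a| := by
      calc (s * u).re ≤ ‖s * (u : ℂ)‖ := Complex.re_le_norm _
        _ = ‖s‖ * |u| := by rw [norm_mul, Complex.norm_real, Real.norm_eq_abs]
        _ ≤ (‖s₀‖ + 1) * |a| := by gcongr
    calc Real.exp (s * u).re * |u| * ‖φ u‖ ≤ Real.exp ((‖s₀‖ + 1) * |a|) * |a| * ‖φ u‖ := by gcongr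
      _ = |a| * Real.exp ((‖s₀‖ + 1) * |a|) * ‖φ u‖ := by ring
  · exact hφ.norm.const_mul _
  · refine Eventually.of_forall fun u s _ ↦ ?_
    have h1 : HasDerivAt (fun s : ℂ ↦ cexp (s * u)) (cexp (s * u) * u) s := by
      simpa using ((hasDerivAt_id s).mul_const (u : ℂ)).cexp
    exact (h1.sub_const 1).mul_const (φ u)

/-- `D_φ` is entire. [folklore] -/
private theorem differentiable_expMoment {φ : ℝ → ℂ}
    (hφ : Integrable φ (volume.restrict (Ioo (-a) a))) :
    Differentiable ℂ (fun s : ℂ ↦ ∫ u, (cexp (s * u) - 1) * φ u ∂(volume.restrict (Ioo (-a) a))) :=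
  fun s ↦ (hasDerivAt_expMoment hφ s).differentiableAt

/-- `|D_φ(s)| ≤ (e^{|s| a} + 1) ‖φ‖₁`. [folklore] -/
private theorem norm_expMoment_le {φ : ℝ → ℂ}
    (hφ : Integrable φ (volume.restrict (Ioo (-a) a))) (s : ℂ) :
    ‖∫ u, (cexp (s * u) - 1) * φ u ∂(volume.restrict (Ioo (-a) a))‖ ≤
      (Real.exp (‖s‖ * a) + 1) * ∫ u, ‖φ u‖ ∂(volume.restrict (Ioo (-a) a)) := by
  rw [← integral_const_mul]
  refine norm_integral_le_of_norm_le (hφ.norm.const_mul _) (ae_abs_le.mono fun u hu ↦ ?_)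
  rw [norm_mul]
  exact mul_le_mul_of_nonneg_right (norm_exp_sub_one_le s hu) (norm_nonneg _)

/-! ### Step 5. Vanishing of all exponential moments forces `φ = 0` (Riemann–Lebesgue and the
uniqueness theorem for the Fourier transform on `L¹`) -/

/-- If `∫_{−a}^{a} (e^{su} − 1) φ(u) du = 0` for every `s ∈ ℂ`, then `φ = 0` a.e. on `(−a,a)`. [folklore] -/
private theorem ae_eq_zero_of_forall_expMoment {φ : ℝ → ℂ}
    (hφ : Integrable φ (volume.restrict (Ioo (-a) a)))
    (h : ∀ s : ℂ, ∫ u, (cexp (s * u) - 1) * φ u ∂(volume.restrict (Ioo (-a) a)) = 0) :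
    φ =ᵐ[volume.restrict (Ioo (-a) a)] 0 := by
  set α : ℂ := ∫ u, φ u ∂(volume.restrict (Ioo (-a) a)) with hα
  -- all exponential moments equal `α`
  have hmom : ∀ s : ℂ, ∫ u, cexp (s * u) * φ u ∂(volume.restrict (Ioo (-a) a)) = α := by
    intro s
    have hs := h s
    have hsplit : ∫ u, (cexp (s * u) - 1) * φ u ∂(volume.restrict (Ioo (-a) a)) =
        (∫ u, cexp (s * u) * φ u ∂(volume.restrict (Ioo (-a) a))) - α := by
      rw [hα, ← integral_sub _ hφ]
      · congr 1; funext u; ring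
      · exact hφ.bdd_mul (c := Real.exp (‖s‖ * a)) (Continuous.aestronglyMeasurable (by fun_prop))
          (ae_abs_le.mono fun u hu ↦ by
            rw [Complex.norm_exp]
            exact Real.exp_le_exp.mpr ((Complex.re_le_norm _).trans (by
              rw [norm_mul, Complex.norm_real, Real.norm_eq_abs]; gcongr)))
    rw [hsplit] at hs
    exact (sub_eq_zero.mp hs)
  -- the Fourier transform of `𝟙_{(−a,a)} φ` is the constant `α`
  set f : ℝ → ℂ := (Ioo (-a) a).indicator φ with hf
  have hfi : Integrable f := (integrable_indicator_iff measurableSet_Ioo).mpr hφ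
  have hF : ∀ ξ : ℝ, 𝓕 f ξ = α := by
    intro ξ
    rw [Real.fourier_real_eq_integral_exp_smul]
    have hpt : (fun v : ℝ ↦ cexp (↑(-2 * π * v * ξ) * I) • f v) =
        (Ioo (-a) a).indicator (fun v : ℝ ↦ cexp ((↑(-2 * π * ξ) * I) * v) * φ v) := by
      funext v
      rw [hf, smul_eq_mul]
      by_cases hv : v ∈ Ioo (-a) a
      · rw [indicator_of_mem hv, indicator_of_mem hv]; congr 1; push_cast; ring_nf
      · rw [indicator_of_notMem hv, indicator_of_notMem hv, mul_zero]
    rw [hpt, integral_indicator measurableSet_Ioo]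
    exact hmom _
  -- Riemann–Lebesgue: `α = 0`
  have hα0 : α = 0 := by
    have hRL := Real.zero_at_infty_fourier f
    rw [show 𝓕 f = fun _ ↦ α from funext hF] at hRL
    exact tendsto_const_nhds_iff.mp hRL
  -- uniqueness: `f = 0` a.e.
  have hf0 : f =ᵐ[volume] 0 :=
    Literature.Analysis.Fourier.ae_eq_zero_of_forall_fourier_eq_zero hfi fun ξ ↦ by
      rw [hF, hα0]
  refine (ae_restrict_iff' measurableSet_Ioo).mpr (hf0.mono fun x hx hxS ↦ ?_)
  have : f x = φ x := by rw [hf, indicator_of_mem hxS]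
  rw [← this]; exact hx


end ZetaScrewPosdef

open ZetaScrewPosdef ZetaScrewProp31 in
/-- **DISCHARGE of `Suzuki2023_thm13_posdef` (Suzuki2023 Thm. 1.3, the "Moreover" clause):** under
RH, `⟨φ,φ⟩_{G_g,a} > 0` for every `0 ≠ φ ∈ L²(−a,a)` and every `0 < a < ∞`. Proof as printed
(§3.1, p. 7): by (3.1)–(3.2) the form is `Σ_γ m |(φ̂(γ) − φ̂(0))/γ|² ≥ 0` when all `γ` are real
(Steps 1–3: here `Σ_ρ m(ρ)(|D_φ(κ_ρ)|² + |D_φ(−κ_ρ)|²)/(2(Im ρ)²)` with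
`D_φ(s) = ∫(e^{su} − 1)φ(u) du = φ̂ − φ̂(0)` in the variable `s = −iz`), and `= 0` forces
`φ̂(γ) = φ̂(0)` at every zero `γ` of `ξ(1/2 − iz)`, whence `φ̂` is constant by Lemma 2.1
(`Suzuki2023_lemma21_holds`; Step 4: `D_φ` is entire of exponential type) and `φ = 0`
(Step 5: Riemann–Lebesgue and Fourier uniqueness on `L¹`). [cite: Suzuki2023, Thm 1.3 and §3.1 (3.1)–(3.2), pp. 3, 7] -/
theorem Suzuki2023_thm13_posdef_holds : Suzuki2023_thm13_posdef := by
  intro hRH a ha φ hφ0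
  have hφi : Integrable (φ : ℝ → ℂ) (volume.restrict (Ioo (-a) a)) :=
    (Lp.memLp φ).integrable one_le_two
  -- Steps 2–3: `⟨φ,φ⟩ = Σ_ρ r(ρ)` with `r(ρ) ≥ 0`
  have hS := hasSum_integral_term hφi hφi
  rw [← zetaScrewForm_eq_integral_prod hφi hφi] at hS
  set D : ℂ → ℂ := fun s ↦ ∫ u, (cexp (s * u) - 1) * (φ : ℝ → ℂ) u ∂(volume.restrict (Ioo (-a) a))
    with hD
  set r : ZetaZeros.riemannZetaNontrivialZeros → ℝ := fun ρ ↦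
    (riemannZetaZeroOrder (ρ : ℂ) : ℝ) *
      (‖D ((ρ : ℂ) - 1 / 2)‖ ^ 2 + ‖D (-((ρ : ℂ) - 1 / 2))‖ ^ 2) / (2 * (ρ : ℂ).im ^ 2) with hr
  have hterm := fun ρ ↦ integral_term_of_RH hRH ρ hφi
  have hSr : HasSum (fun ρ ↦ ((r ρ : ℝ) : ℂ)) (zetaScrewForm (Ioo (-a) a) φ φ) := by
    refine hS.congr_fun fun ρ ↦ ?_
    rw [hterm ρ]
  have hr0 : ∀ ρ, 0 ≤ r ρ := fun ρ ↦ by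
    have hm : (0 : ℝ) ≤ riemannZetaZeroOrder (ρ : ℂ) := ZetaZeroSum.zeroOrder_nonneg ρ
    positivity
  have hRe : HasSum r (zetaScrewForm (Ioo (-a) a) φ φ).re := by
    simpa using hSr.mapL Complex.reCLM
  have hIm : (zetaScrewForm (Ioo (-a) a) φ φ).im = 0 := by
    have h := hSr.mapL Complex.imCLM
    simp only [Complex.imCLM_apply, Complex.ofReal_im] at h
    exact h.unique hasSum_zero
  have hnn : 0 ≤ (zetaScrewForm (Ioo (-a) a) φ φ).re := hRe.nonneg hr0
  rcases hnn.lt_or_eq with hpos | hzero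
  · exact Complex.lt_def.mpr ⟨by simpa using hpos, by simp [hIm]⟩
  exfalso
  -- all terms vanish: `D(κ_ρ) = 0` for every zero
  have hr00 : r = 0 := (hasSum_zero_iff_of_nonneg hr0).mp (hzero ▸ hRe)
  have hD0 : ∀ ρ : ZetaZeros.riemannZetaNontrivialZeros, D ((ρ : ℂ) - 1 / 2) = 0 := by
    intro ρ
    have h := congrFun hr00 ρ
    simp only [hr, Pi.zero_apply, div_eq_zero_iff, mul_eq_zero] at h
    have hm : (0 : ℝ) < riemannZetaZeroOrder (ρ : ℂ) := by
      have := ZetaZeros.riemannZetaNontrivialZeros.one_le_order ρ.2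
      exact_mod_cast Int.one_pos.trans_le this
    have hτ : (ρ : ℂ).im ≠ 0 := ZetaZeros.riemannZetaNontrivialZeros.im_ne_zero ρ.2
    rcases h with (h | h) | h
    · exact absurd h hm.ne'
    · have h2 : ‖D ((ρ : ℂ) - 1 / 2)‖ ^ 2 = 0 := by
        nlinarith [sq_nonneg ‖D ((ρ : ℂ) - 1 / 2)‖, sq_nonneg ‖D (-((ρ : ℂ) - 1 / 2))‖]
      exact norm_eq_zero.mp (pow_eq_zero_iff two_ne_zero |>.mp h2)
    · rcases h with h | h
      · norm_num at h
      · exact absurd h (pow_ne_zero 2 hτ)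
  -- Step 4 + Lemma 2.1: `F(w) = D(−iw)` is entire of exponential type and vanishes at the zeros
  -- of `ξ(1/2 − iz)`, hence identically; so every exponential moment of `φ` vanishes
  have hDd : Differentiable ℂ D := differentiable_expMoment hφi
  have hF : ∀ w : ℂ, D (-(I * w)) = 0 := by
    refine Suzuki2023_lemma21_holds (fun w ↦ D (-(I * w))) (hDd.comp ((differentiable_id.const_mul I).neg))
      ⟨2 * ∫ u, ‖(φ : ℝ → ℂ) u‖ ∂(volume.restrict (Ioo (-a) a)), a, fun w ↦ ?_⟩ 0 ?_
    · have hL : 0 ≤ ∫ u, ‖(φ : ℝ → ℂ) u‖ ∂(volume.restrict (Ioo (-a) a)) :=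
        integral_nonneg fun _ ↦ norm_nonneg _
      have h1 := norm_expMoment_le hφi (-(I * w))
      have hn : ‖-(I * w)‖ = ‖w‖ := by rw [norm_neg, norm_mul, Complex.norm_I, one_mul]
      rw [hn] at h1
      have he : 1 ≤ Real.exp (a * ‖w‖) := Real.one_le_exp (by positivity)
      calc ‖D (-(I * w))‖ ≤ (Real.exp (‖w‖ * a) + 1) * ∫ u, ‖(φ : ℝ → ℂ) u‖ ∂(volume.restrict (Ioo (-a) a)) := h1
        _ ≤ (2 * ∫ u, ‖(φ : ℝ → ℂ) u‖ ∂(volume.restrict (Ioo (-a) a))) * Real.exp (a * ‖w‖) := by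
            rw [mul_comm ‖w‖ a]; nlinarith
    · intro γ hγ
      have hmem := mem_riemannZetaNontrivialZeros_of_riemannXi_eq_zero hγ
      have h := hD0 ⟨1 / 2 - I * γ, hmem⟩
      have he : ((1 / 2 - I * γ : ℂ)) - 1 / 2 = -(I * γ) := by ring
      simpa [he] using h
  have hDall : ∀ s : ℂ, D s = 0 := fun s ↦ by
    have h := hF (I * s)
    have he : -(I * (I * s)) = s := by rw [← mul_assoc, Complex.I_mul_I]; ring
    rwa [he] at h
  -- Step 5: `φ = 0`
  exact hφ0 (Lp.eq_zero_iff_ae_eq_zero.mpr (ae_eq_zero_of_forall_expMoment hφi hDall))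

/-- **Thm. 1.4, direction `RH ⟹ non-degenerate`** (§5.1 of the source: immediate from the strict
positivity of Thm. 1.3 under RH — `⟨φ₁,φ₂⟩ = 0` for all `φ₂` gives `⟨φ₁,φ₁⟩ = 0`, so `φ₁ = 0`).
The converse (§5.2, via Yoshida's Thm. 4.3) is not formalized; the `iff` stays the named fact
`Suzuki2023_thm14`. [cite: Suzuki2023, Thm 1.4 (⟹) and §5.1, pp. 3, 15] -/
theorem isScrewFormNondegenerate_of_riemannHypothesis (hRH : RiemannHypothesis) {a : ℝ}
    (ha : 0 < a) : IsScrewFormNondegenerate a := by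
  intro φ₁ hφ₁
  by_contra hne
  have hpos := Suzuki2023_thm13_posdef_holds hRH a ha φ₁ hne
  rw [hφ₁ φ₁] at hpos
  exact lt_irrefl _ hpos

end Literature.NumberTheory.LFunctions

end
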